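import Mathlib
import Summits.ValiantsHypothesis.ValiantsHypothesis.Theorems.LiouvilleSarnakAlignedTypeICharactersMod2nBilinearSievePrimeSums
import Summits.ValiantsHypothesis.ValiantsHypothesis.Theorems.LiouvilleSarnakAlignedTypeICharactersMod2nBilinearSieveAssembly
import HarnessLib

/-!
# Route LiouvilleSarnak — support `AlignedTypeI` (stmt-ValiantsHypothesis-21040), line `characters_mod_2n`:
# (PCS) from log-weighted prime character sums

`alignedTypeI_of_primeCharSums` (`…BilinearSieveAssembly.lean`) closes the leaf from (PCS), a statement about the UNWEIGHTED
prime sums `Σ_{p ≤ u} ψ(p)`.  The literature (Banks–Shparlinski 2019 Thm 2.2, after `…BilinearSieveVonMangoldt.lean`) delivers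
LOG-WEIGHTED sums.  This file proves, by the discrete partial summation of `…BilinearSievePrimeSums.lean`, that the
log-weighted form implies (PCS):

  (PCSθ)  ∀ θ > 0, ∀ η > 0, ∃ k₁, ∀ k ≥ k₁, ∀ ψ ≠ 1 (mod 2^k), ∀ a ≥ θk, ∀ t ≥ 2^a:  ‖Σ_{p ≤ t} (log p) ψ(p)‖ ≤ η t
  ⟹ (PCS) ∀ θ > 0, ∀ η > 0, ∃ k₁, ∀ k ≥ k₁, ∀ ψ ≠ 1 (mod 2^k), ∀ a ≥ θk, ∀ u ≥ 2^a:  ‖Σ_{p ≤ u} ψ(p)‖ ≤ η u / log u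

(`primeCharSums_of_logWeighted`; (PCSθ) is used at `θ/2`, with the trivial bound `θ(t) ≤ (log 4 + 4) t` below `2^{⌈a/2⌉}`).

HONEST FRAMING. Bookkeeping only (no number theory beyond Chebyshev's bound); `AlignedTypeI` is NOT closed here; nothing
bears on `VP ≠ VNP` (NOT proved).
-/

set_option linter.dupNamespace false

noncomputable section

namespace Summit.ValiantsHypothesis.ValiantsHypothesis.Theorems.LiouvilleSarnak.AlignedTypeI.CharactersModTwoN

open Finset
open scoped BigOperators Chebyshev

/-- `log u ≤ 4 √√u` for `u > 0`. [folklore] -/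
theorem log_le_four_mul_sqrt_sqrt {u : ℝ} (hu : 0 < u) : Real.log u ≤ 4 * Real.sqrt (Real.sqrt u) := by
  have h1 : Real.log (Real.sqrt (Real.sqrt u)) = Real.log u / 2 / 2 := by
    rw [Real.log_sqrt (Real.sqrt_nonneg _), Real.log_sqrt hu.le]
  have hw : 0 < Real.sqrt (Real.sqrt u) := Real.sqrt_pos.mpr (Real.sqrt_pos.mpr hu)
  have h2 := Real.log_le_sub_one_of_pos hw
  rw [h1] at h2
  linarith

/-- The trivial Chebyshev bound for log-weighted character sums over primes: `‖Σ_{p ≤ t} (log p) c(p)‖ ≤ (log 4 + 4) t`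
for `|c| ≤ 1` (here for character values). [folklore] -/
theorem norm_logWeighted_char_le {q : ℕ} (χ : DirichletCharacter ℂ q) (t : ℕ) :
    ‖∑ p ∈ (Finset.Iic t).filter Nat.Prime, (Real.log p : ℂ) * χ (p : ZMod q)‖ ≤ (Real.log 4 + 4) * t := by
  classical
  have hset : (Finset.Iic t).filter Nat.Prime = (Finset.Ioc 0 t).filter Nat.Prime := by
    ext p
    simp only [Finset.mem_filter, Finset.mem_Iic, Finset.mem_Ioc]
    constructor
    · rintro ⟨hp, hpp⟩
      exact ⟨⟨hpp.pos, hp⟩, hpp⟩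
    · rintro ⟨⟨_, hp⟩, hpp⟩
      exact ⟨hp, hpp⟩
  have htheta : θ (t : ℝ) = ∑ p ∈ (Finset.Iic t).filter Nat.Prime, Real.log p := by
    rw [Chebyshev.theta, Nat.floor_natCast, hset]
  calc ‖∑ p ∈ (Finset.Iic t).filter Nat.Prime, (Real.log p : ℂ) * χ (p : ZMod q)‖
      ≤ ∑ p ∈ (Finset.Iic t).filter Nat.Prime, ‖(Real.log p : ℂ) * χ (p : ZMod q)‖ := norm_sum_le _ _
    _ ≤ ∑ p ∈ (Finset.Iic t).filter Nat.Prime, Real.log p := by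
        refine Finset.sum_le_sum fun p hp => ?_
        have hpp := (Finset.mem_filter.mp hp).2
        have hlog : 0 ≤ Real.log p := Real.log_nonneg (by exact_mod_cast hpp.one_lt.le)
        rw [norm_mul, Complex.norm_real, Real.norm_eq_abs, abs_of_nonneg hlog]
        calc Real.log p * ‖χ (p : ZMod q)‖ ≤ Real.log p * 1 := mul_le_mul_of_nonneg_left (χ.norm_le_one _) hlog
          _ = Real.log p := mul_one _
    _ = θ (t : ℝ) := htheta.symm
    _ ≤ ψ (t : ℝ) := Chebyshev.theta_le_psi _
    _ ≤ (Real.log 4 + 4) * t := Chebyshev.psi_le_const_mul_self (Nat.cast_nonneg t)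

set_option maxHeartbeats 400000 in
/-- **(PCS) from its log-weighted form** (see the module docstring). [folklore] -/
theorem primeCharSums_of_logWeighted
    (h : ∀ th : ℝ, 0 < th → ∀ η : ℝ, 0 < η → ∃ k₁ : ℕ, ∀ k : ℕ, k₁ ≤ k →
      ∀ χ : DirichletCharacter ℂ (2 ^ k), χ ≠ 1 → ∀ a : ℕ, th * k ≤ a → ∀ t : ℕ, 2 ^ a ≤ t →
        ‖∑ p ∈ (Finset.Iic t).filter Nat.Prime, (Real.log p : ℂ) * χ (p : ZMod (2 ^ k))‖ ≤ η * t) :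
    ∀ th : ℝ, 0 < th → ∀ η : ℝ, 0 < η → ∃ k₁ : ℕ, ∀ k : ℕ, k₁ ≤ k →
      ∀ χ : DirichletCharacter ℂ (2 ^ k), χ ≠ 1 → ∀ a : ℕ, th * k ≤ a → ∀ u : ℕ, 2 ^ a ≤ u →
        ‖∑ p ∈ (Finset.Iic u).filter Nat.Prime, χ (p : ZMod (2 ^ k))‖ ≤ η * u / Real.log u := by
  intro th hth η hη
  obtain ⟨η₁, hη₁⟩ : ∃ η₁ : ℝ, η₁ = η / 10 := ⟨_, rfl⟩
  have hη₁0 : 0 < η₁ := by rw [hη₁]; positivity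
  obtain ⟨k₁, hk₁⟩ := h (th / 2) (by positivity) η₁ hη₁0
  -- size threshold: `u ≥ 2^N` with `√√u ≥ W := max 17 (800/η)`
  set W : ℝ := max 17 (800 / η) with hW
  have hW17 : (17 : ℝ) ≤ W := le_max_left _ _
  have hWη : 800 / η ≤ W := le_max_right _ _
  obtain ⟨N, hN⟩ : ∃ N : ℕ, W ^ 4 < (2 : ℝ) ^ N := pow_unbounded_of_one_lt _ (by norm_num : (1 : ℝ) < 2)
  obtain ⟨K, hK⟩ : ∃ K : ℕ, ((N : ℝ) + 2) / th ≤ K := exists_nat_ge _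
  refine ⟨max k₁ K, fun k hk χ hχ a ha u hu => ?_⟩
  have hk₁k : k₁ ≤ k := le_trans (le_max_left _ _) hk
  have hKk : K ≤ k := le_trans (le_max_right _ _) hk
  -- `a ≥ N + 2`
  have haN : N + 2 ≤ a := by
    have h1 : ((N : ℝ) + 2) ≤ th * K := by rwa [div_le_iff₀ hth, mul_comm] at hK
    have h2 : th * K ≤ th * k := mul_le_mul_of_nonneg_left (by exact_mod_cast hKk) hth.le
    have h3 : ((N : ℝ) + 2) ≤ a := h1.trans (h2.trans ha)
    exact_mod_cast h3
  -- the split point `u₀ = 2^a'`, `a' = ⌈a/2⌉ = (a+1)/2`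
  set a' : ℕ := (a + 1) / 2 with ha'
  have ha'a : a' ≤ a := by omega
  have h2a' : a ≤ 2 * a' := by omega
  have h2a'' : 2 * a' ≤ a + 1 := by omega
  have hθa' : th / 2 * k ≤ a' := by
    have : (a : ℝ) ≤ 2 * a' := by exact_mod_cast h2a'
    linarith
  set u₀ : ℕ := 2 ^ a' with hu₀
  have ha'1 : 1 ≤ a' := by omega
  have hu₀2 : 2 ≤ u₀ := by
    rw [hu₀]
    calc 2 = 2 ^ 1 := by norm_num
      _ ≤ 2 ^ a' := Nat.pow_le_pow_right (by norm_num) ha'1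
  have hu₀u : u₀ ≤ u := le_trans (Nat.pow_le_pow_right (by norm_num) ha'a) hu
  -- the two regimes of the log-weighted sums
  have hA₀ : ∀ t : ℕ, t < u₀ →
      ‖∑ p ∈ (Finset.Iic t).filter Nat.Prime, (Real.log p : ℂ) * χ (p : ZMod (2 ^ k))‖ ≤ (Real.log 4 + 4) * t :=
    fun t _ => norm_logWeighted_char_le χ t
  have hA : ∀ t : ℕ, u₀ ≤ t → t ≤ u →
      ‖∑ p ∈ (Finset.Iic t).filter Nat.Prime, (Real.log p : ℂ) * χ (p : ZMod (2 ^ k))‖ ≤ η₁ * t :=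
    fun t ht _ => hk₁ k hk₁k χ hχ a' hθa' t ht
  have hM0 : (0 : ℝ) ≤ Real.log 4 + 4 := by positivity
  have hmain := norm_sum_primes_le_of_logWeighted (fun p => χ (p : ZMod (2 ^ k))) hη₁0.le hM0 hu₀2 hu₀u hA₀ hA
  refine hmain.trans ?_
  clear hmain hA hA₀ hk₁ h
  ------------------------------------------------------------------------------------------------
  -- real-variable facts about `u`
  have huR : (2 : ℝ) ^ a ≤ u := by exact_mod_cast hu
  have hu0 : (0 : ℝ) < u := lt_of_lt_of_le (by positivity) huR
  have hu4 : (4 : ℝ) ≤ u := le_trans (by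
    calc (4 : ℝ) = 2 ^ 2 := by norm_num
      _ ≤ 2 ^ a := pow_le_pow_right₀ (by norm_num) (by omega)) huR
  obtain ⟨w, hw⟩ : ∃ w : ℝ, w = Real.sqrt (Real.sqrt u) := ⟨_, rfl⟩
  have hw0 : 0 ≤ w := by rw [hw]; exact Real.sqrt_nonneg _
  have hw2 : w ^ 2 = Real.sqrt u := by rw [hw]; exact Real.sq_sqrt (Real.sqrt_nonneg _)
  have hw4 : w ^ 4 = (u : ℝ) := by
    calc w ^ 4 = (w ^ 2) ^ 2 := by ring
      _ = (u : ℝ) := by rw [hw2, Real.sq_sqrt hu0.le]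
  have hlogu : Real.log u ≤ 4 * w := by rw [hw]; exact log_le_four_mul_sqrt_sqrt hu0
  have hlogu1 : 1 ≤ Real.log u := by
    rw [← Real.log_exp 1]
    refine Real.log_le_log (Real.exp_pos 1) (le_trans ?_ hu4)
    have := Real.exp_one_lt_d9
    linarith
  have hlogu0 : 0 < Real.log u := by linarith
  -- `W ≤ w` (from `u ≥ 2^a ≥ 2^N > W^4`)
  have hWw : W ≤ w := by
    have h1 : W ^ 4 ≤ u := by
      refine hN.le.trans (le_trans ?_ huR)
      exact pow_le_pow_right₀ (by norm_num) (by omega)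
    have hW0 : 0 ≤ W := le_trans (by norm_num) hW17
    by_contra hlt
    rw [not_le] at hlt
    have : w ^ 4 < W ^ 4 := pow_lt_pow_left₀ hlt hw0 (by norm_num)
    linarith
  have hw17 : 17 ≤ w := hW17.trans hWw
  -- `√u ≤ u / (17 log u)`-type facts, all polynomial in `w`
  have hsqrt : Real.sqrt u = w ^ 2 := hw2.symm
  ------------------------------------------------------------------------------------------------
  -- the `η₁ Σ_{u₀ ≤ i < u} 1/log² i` term
  set v : ℕ := max u₀ (Nat.sqrt u + 1) with hv
  have hu₀v : u₀ ≤ v := le_max_left _ _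
  have hvu : v ≤ u := by
    refine max_le hu₀u ?_
    have : Nat.sqrt u < u := Nat.sqrt_lt_self (by omega)
    omega
  have hS₁ := sum_Ico_inv_log_sq_le hu₀2 hu₀v hvu
  have hvR : Real.sqrt u ≤ v := by
    have h1 : Real.sqrt (u : ℝ) ≤ Nat.sqrt u + 1 := Real.real_sqrt_le_nat_sqrt_succ
    have h2 : ((Nat.sqrt u + 1 : ℕ) : ℝ) ≤ v := by exact_mod_cast le_max_right _ _
    push_cast at h2
    linarith
  have hvsub : (v : ℝ) - u₀ ≤ Real.sqrt u + 1 := by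
    rcases le_total u₀ (Nat.sqrt u + 1) with hcase | hcase
    · have : v = Nat.sqrt u + 1 := max_eq_right hcase
      rw [this]
      push_cast
      have := Real.nat_sqrt_le_real_sqrt (a := u)
      have hu₀0 : (0 : ℝ) ≤ u₀ := Nat.cast_nonneg _
      linarith
    · have : v = u₀ := max_eq_left hcase
      rw [this]
      have := Real.sqrt_nonneg (u : ℝ)
      linarith
  have hlogv : Real.log u / 2 ≤ Real.log v := by
    rw [← Real.log_sqrt hu0.le]
    exact Real.log_le_log (Real.sqrt_pos.mpr hu0) hvR
  have hlog2 : (1 : ℝ) / 2 < Real.log 2 := by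
    have := Real.log_two_gt_d9
    linarith
  have hlog2pos : (0 : ℝ) < Real.log 2 := by linarith
  have hlogu₀ : Real.log 2 ≤ Real.log u₀ := by
    refine Real.log_le_log (by norm_num) ?_
    exact_mod_cast hu₀2
  have hT1 : ((v : ℝ) - u₀) / Real.log u₀ ^ 2 ≤ 4 * (Real.sqrt u + 1) := by
    have hhalf : (1 : ℝ) / 2 ≤ Real.log u₀ := by linarith
    have hl : (1 : ℝ) / 4 ≤ Real.log u₀ ^ 2 := by
      have := mul_le_mul hhalf hhalf (by norm_num) (by linarith)
      have e : (1 : ℝ) / 2 * (1 / 2) = 1 / 4 := by norm_num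
      rw [sq]
      linarith
    have hlpos : 0 < Real.log u₀ ^ 2 := by linarith
    rw [div_le_iff₀ hlpos]
    have h0 : 0 ≤ Real.sqrt (u : ℝ) + 1 := by positivity
    have h5 := mul_le_mul_of_nonneg_left hl (show (0 : ℝ) ≤ 4 * (Real.sqrt u + 1) by positivity)
    linarith
  have hT2 : ((u : ℝ) - v) / Real.log v ^ 2 ≤ 4 * u / Real.log u ^ 2 := by
    have hlv0 : 0 < Real.log v := by linarith
    rw [div_le_div_iff₀ (by positivity) (by positivity)]
    have hv0 : (0 : ℝ) ≤ v := Nat.cast_nonneg _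
    have h1 : ((u : ℝ) - v) ≤ u := by linarith
    have h2 : Real.log u ^ 2 ≤ 4 * Real.log v ^ 2 := by
      have h3 : Real.log u / 2 * (Real.log u / 2) ≤ Real.log v * Real.log v :=
        mul_le_mul hlogv hlogv (by linarith) (by linarith)
      linarith
    calc ((u : ℝ) - v) * Real.log ↑u ^ 2 ≤ u * (4 * Real.log v ^ 2) := by gcongr
      _ = 4 * u * Real.log v ^ 2 := by ring
  have hS₁' : ∑ i ∈ Finset.Ico u₀ u, 1 / Real.log (i : ℝ) ^ 2 ≤ 4 * (Real.sqrt u + 1) + 4 * u / Real.log u ^ 2 :=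
    hS₁.trans (add_le_add hT1 hT2)
  -- the `M Σ_{2 ≤ i < u₀} 1/log² i` term
  have hS₀ := sum_Ico_inv_log_sq_le (le_refl 2) hu₀2 le_rfl
  have hS₀' : ∑ i ∈ Finset.Ico 2 u₀, 1 / Real.log (i : ℝ) ^ 2 ≤ 4 * (u₀ : ℝ) := by
    refine hS₀.trans ?_
    have hl2sq : 0 < Real.log 2 ^ 2 := by positivity
    push_cast
    rw [sub_self, zero_div, add_zero, div_le_iff₀ hl2sq]
    have h0 : (0 : ℝ) ≤ u₀ := Nat.cast_nonneg _
    have h4 : 1 ≤ 4 * Real.log 2 ^ 2 := by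
      have := mul_le_mul hlog2.le hlog2.le (by norm_num) hlog2pos.le
      linarith
    have h5 := mul_le_mul_of_nonneg_left h4 h0
    linarith
  -- `u₀ ≤ 2 √u`: `u₀² = 2^(2a') ≤ 2^(a+1) ≤ 2u`
  have hu₀sq : (u₀ : ℝ) ≤ 2 * Real.sqrt u := by
    have h1 : ((u₀ : ℝ)) ^ 2 ≤ 2 * u := by
      have : u₀ ^ 2 ≤ 2 * 2 ^ a := by
        rw [hu₀, ← pow_mul, ← pow_succ']
        exact Nat.pow_le_pow_right (by norm_num) (by omega)
      calc ((u₀ : ℝ)) ^ 2 = ((u₀ ^ 2 : ℕ) : ℝ) := by push_cast; ring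
        _ ≤ ((2 * 2 ^ a : ℕ) : ℝ) := by exact_mod_cast this
        _ = 2 * (2 : ℝ) ^ a := by push_cast; ring
        _ ≤ 2 * u := by linarith
    have h0 : (0 : ℝ) ≤ u₀ := Nat.cast_nonneg _
    have h3 : (2 * Real.sqrt (u : ℝ)) ^ 2 = 4 * u := by rw [mul_pow, Real.sq_sqrt hu0.le]; ring
    exact (pow_le_pow_iff_left₀ h0 (by positivity) two_ne_zero).mp (by rw [h3]; linarith)
  ------------------------------------------------------------------------------------------------
  -- final numerics, in the variable `w` (`√u = w²`, `u = w⁴`, `log u ≤ 4w`, `w ≥ W ≥ max 17 (800/η)`)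
  have hηw : 800 ≤ η * w := by
    have := (div_le_iff₀ hη).mp (hWη.trans hWw)
    linarith
  -- everything over the common bound `η₁ u / log u`
  have hUL : 0 ≤ (u : ℝ) / Real.log u := div_nonneg hu0.le hlogu0.le
  have hLw : Real.log u ≤ 4 * w := hlogu
  have hw3 : 17 * w ^ 2 ≤ w ^ 3 := by
    have h := mul_nonneg (mul_nonneg hw0 hw0) (sub_nonneg.mpr hw17)
    have h' : w * w * (w - 17) = w ^ 3 - 17 * w ^ 2 := by ring
    rw [h'] at h
    linarith
  have hw4' : 17 * w ^ 3 ≤ w ^ 4 := by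
    have h := mul_nonneg (pow_nonneg hw0 3) (sub_nonneg.mpr hw17)
    have h' : w ^ 3 * (w - 17) = w ^ 4 - 17 * w ^ 3 := by ring
    rw [h'] at h
    linarith
  have hw1 : 17 * w ≤ w ^ 2 := by
    have h := mul_nonneg hw0 (sub_nonneg.mpr hw17)
    have h' : w * (w - 17) = w ^ 2 - 17 * w := by ring
    rw [h'] at h
    linarith
  have hii : 4 * (Real.sqrt u + 1) ≤ (u : ℝ) / Real.log u := by
    rw [hsqrt, le_div_iff₀ hlogu0]
    calc 4 * (w ^ 2 + 1) * Real.log u ≤ 4 * (w ^ 2 + 1) * (4 * w) := by gcongr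
      _ = 16 * w ^ 3 + 16 * w := by ring
      _ ≤ w ^ 4 := by linarith
      _ = (u : ℝ) := hw4
  have hiii : 4 * (u : ℝ) / Real.log u ^ 2 ≤ 4 * ((u : ℝ) / Real.log u) := by
    have hLL : Real.log u ≤ Real.log u ^ 2 := by
      calc Real.log u = Real.log u * 1 := (mul_one _).symm
        _ ≤ Real.log u * Real.log u := mul_le_mul_of_nonneg_left hlogu1 hlogu0.le
        _ = Real.log u ^ 2 := (sq _).symm
    calc 4 * (u : ℝ) / Real.log u ^ 2 ≤ 4 * (u : ℝ) / Real.log u :=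
          div_le_div_of_nonneg_left (by positivity) hlogu0 hLL
      _ = 4 * ((u : ℝ) / Real.log u) := by ring
  have hiv : (Real.log 4 + 4) * (4 * (u₀ : ℝ)) ≤ 3 * η₁ * ((u : ℝ) / Real.log u) := by
    have hl4 : Real.log 4 + 4 ≤ 7 := by
      have : Real.log 4 ≤ 4 - 1 := Real.log_le_sub_one_of_pos (by norm_num)
      linarith
    have hu₀' : (u₀ : ℝ) ≤ 2 * w ^ 2 := by rw [← hsqrt]; exact hu₀sq
    have h75 : 75 ≤ η₁ * w := by rw [hη₁]; linarith
    have hstep : (Real.log 4 + 4) * (4 * (u₀ : ℝ)) ≤ 56 * w ^ 2 := by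
      have h0 : (0 : ℝ) ≤ u₀ := Nat.cast_nonneg _
      calc (Real.log 4 + 4) * (4 * (u₀ : ℝ)) ≤ 7 * (4 * (2 * w ^ 2)) :=
            mul_le_mul hl4 (by linarith) (by positivity) (by norm_num)
        _ = 56 * w ^ 2 := by ring
    refine hstep.trans ?_
    rw [mul_div_assoc', le_div_iff₀ hlogu0]
    calc 56 * w ^ 2 * Real.log u ≤ 56 * w ^ 2 * (4 * w) := by gcongr
      _ = 224 * w ^ 3 := by ring
      _ ≤ 3 * η₁ * w ^ 4 := by
          have h := mul_nonneg (pow_nonneg hw0 3) (show (0:ℝ) ≤ 3 * η₁ * w - 224 by linarith)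
          have h' : w ^ 3 * (3 * η₁ * w - 224) = 3 * η₁ * w ^ 4 - 224 * w ^ 3 := by ring
          rw [h'] at h
          linarith
      _ = 3 * η₁ * (u : ℝ) := by rw [hw4]
  have hS₁'' : η₁ * ∑ i ∈ Finset.Ico u₀ u, 1 / Real.log (i : ℝ) ^ 2 ≤ η₁ * (5 * ((u : ℝ) / Real.log u)) := by
    refine mul_le_mul_of_nonneg_left (hS₁'.trans ?_) hη₁0.le
    linarith
  have hS₀'' : (Real.log 4 + 4) * ∑ i ∈ Finset.Ico 2 u₀, 1 / Real.log (i : ℝ) ^ 2 ≤ 3 * η₁ * ((u : ℝ) / Real.log u) :=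
    (mul_le_mul_of_nonneg_left hS₀' hM0).trans hiv
  have hfirst : η₁ * (u : ℝ) / Real.log u = η₁ * ((u : ℝ) / Real.log u) := mul_div_assoc _ _ _
  calc η₁ * (u : ℝ) / Real.log u + η₁ * ∑ i ∈ Finset.Ico u₀ u, 1 / Real.log (i : ℝ) ^ 2 +
        (Real.log 4 + 4) * ∑ i ∈ Finset.Ico 2 u₀, 1 / Real.log (i : ℝ) ^ 2
      ≤ η₁ * ((u : ℝ) / Real.log u) + η₁ * (5 * ((u : ℝ) / Real.log u)) + 3 * η₁ * ((u : ℝ) / Real.log u) := by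
        rw [hfirst]
        exact add_le_add (add_le_add le_rfl hS₁'') hS₀''
    _ = 9 * η₁ * ((u : ℝ) / Real.log u) := by ring
    _ ≤ 10 * η₁ * ((u : ℝ) / Real.log u) := by
        have := mul_nonneg hη₁0.le hUL
        linarith
    _ = η * u / Real.log u := by rw [hη₁]; ring


/-- **`AlignedTypeI` from LOG-WEIGHTED prime character sums to `2`-power moduli** (CONDITIONAL by arrow, no def): if for all
`θ, η > 0`, for `k ≥ k₁(θ, η)`, every non-principal `ψ (mod 2^k)`, every `a ≥ θk` and `t ≥ 2^a`,
`‖Σ_{p ≤ t} (log p) ψ(p)‖ ≤ η t` — the `θ(x, χ)` form of Banks–Shparlinski 2019 Thm 2.2 / Gallagher 1972 for the moduli `2^k`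
— then the leaf `AlignedTypeI` holds.  Composition of `primeCharSums_of_logWeighted` and `alignedTypeI_of_primeCharSums`.
[folklore] -/
theorem alignedTypeI_of_logWeightedPrimeCharSums
    (h : ∀ th : ℝ, 0 < th → ∀ η : ℝ, 0 < η → ∃ k₁ : ℕ, ∀ k : ℕ, k₁ ≤ k →
      ∀ χ : DirichletCharacter ℂ (2 ^ k), χ ≠ 1 → ∀ a : ℕ, th * k ≤ a → ∀ t : ℕ, 2 ^ a ≤ t →
        ‖∑ p ∈ (Finset.Iic t).filter Nat.Prime, (Real.log p : ℂ) * χ (p : ZMod (2 ^ k))‖ ≤ η * t) :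
    Summit.ValiantsHypothesis.ValiantsHypothesis.Theses.LiouvilleSarnak.AlignedTypeI :=
  alignedTypeI_of_primeCharSums (primeCharSums_of_logWeighted h)

end Summit.ValiantsHypothesis.ValiantsHypothesis.Theorems.LiouvilleSarnak.AlignedTypeI.CharactersModTwoN
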